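import Literature.NumberTheory.DiophantineGeometry.GarciaStichtenothGenusLocal
import Mathlib.FieldTheory.Finite.Basic
import HarnessLib

/-!
# The Garcia–Stichtenoth tower: `g(G_N) ≤ q^{N+1} - q` (Stichtenoth Thm. 7.4.7, proof; Lemma 7.4.6)

Topic: `Literature/NumberTheory/DiophantineGeometry` (sub-namespace `GSTower`). The genus bound for the
levels `G_N = level K q N` of the tower `x_{i+1}^q - x_{i+1} = x_i^q/(1 - x_i^{q-1})` over a finite
field `K ⊇ 𝔽_q` of characteristic `p`, `q = pⁿ`:

  `GSTower.genus_level_le : g(G_N) ≤ q^{N+1} - q`.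

This is the estimate in the proof of [Stichtenoth 2009, Thm. 7.4.7]: by the Hurwitz genus formula for
`G_N/K(x₀)`, with the ramification locus over the `q + 1` rational places `x₀ ∈ 𝔽_q ∪ {∞}`
(Lemma 7.4.5) and different exponents `d(Q|P) = 2e(Q|P) - 2` (Lemma 7.4.6),
`2g - 2 ≤ -2q^N + (q+1)(2q^N - 2)`. Here the same count is carried out on the divisor `W = (dx₀)` of
the Weil differential `dx₀` (`deg W = 2g - 2`, Cor. 1.5.16), bounded place by place in
`GarciaStichtenothGenusLocal` (`W(P_∞) ≤ -2`, `W ≤ 0` in general position, `W(Q) ≤ 2v_Q(x₀ - β) - 2`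
above `x₀ = β ∈ 𝔽_q`) and summed using `∑_{Q | x₀ = β} v_Q(x₀ - β) deg Q = [G_N : K(x₀)] = q^N`
(Thm. 1.4.11) and `#𝔽_q ≤ q`.

## References

* H. Stichtenoth, *Algebraic Function Fields and Codes*, 2nd ed., GTM 254 (2009): Thm. 7.4.7 (proof),
  Lemmas 7.4.5–7.4.6, Thm. 3.4.13, Cor. 1.5.16, Thm. 1.4.11. [Stichtenoth2009]
-/

noncomputable section

open scoped Classical Polynomial IntermediateField
open Polynomial

namespace Literature.NumberTheory.DiophantineGeometry

open AlgFunctionField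

namespace GSTower

variable {K : Type} [Field K] {q : ℕ} [hq : Fact (2 ≤ q)]
variable {p n : ℕ} [Fact p.Prime] [CharP K p]

namespace Level

variable (L : Level K q)

omit [Fact p.Prime] [CharP K p] in
/-- `x₀ - β` is transcendental and generates `K(x₀)`; its zeros have total degree `q^N`
(`∑_{Q} v_Q(x₀ - β) deg Q = [G_N : K(x₀ - β)] = q^N`, Stichtenoth Thm. 1.4.11).
[cite: Stichtenoth2009, Thm. 1.4.11] -/
theorem sum_ord_sub_mul_degree (β : K) (Z : Finset (PlaceOver K L.carrier))
    (hZ : ∀ Q, Q ∈ Z ↔ 0 < Q.ord (L.x 0 - algebraMap K L.carrier β)) :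
    ∑ Q ∈ Z, Q.ord (L.x 0 - algebraMap K L.carrier β) * (Q.degree : ℤ) = (q : ℤ) ^ L.N := by
  set z := L.x 0 - algebraMap K L.carrier β with hz
  have htr : Transcendental K z := by
    intro halg
    have := halg.add (isAlgebraic_algebraMap (R := K) (A := L.carrier) β)
    rw [hz, sub_add_cancel] at this
    exact L.transcendental_x (Nat.zero_le _) this
  have hadj : K⟮z⟯ = K⟮L.x 0⟯ := by
    apply le_antisymm
    · rw [IntermediateField.adjoin_simple_le_iff]
      exact sub_mem (IntermediateField.mem_adjoin_simple_self K _) (IntermediateField.algebraMap_mem _ β)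
    · rw [IntermediateField.adjoin_simple_le_iff]
      have := add_mem (IntermediateField.mem_adjoin_simple_self K z) (IntermediateField.algebraMap_mem K⟮z⟯ β)
      rwa [hz, sub_add_cancel] at this
  have hsum := sum_ord_mul_degree_eq_finrank htr Z (fun v hv => (hZ v).2 hv)
  rw [Finset.filter_true_of_mem (fun v hv => (hZ v).1 hv), hadj, L.finrank_eq] at hsum
  exact_mod_cast hsum

end Level

/-- **The genus of the levels of the Garcia–Stichtenoth tower: `g(G_N) ≤ q^{N+1} - q`**
(Stichtenoth, proof of Thm. 7.4.7 with Lemmas 7.4.5–7.4.6: `2g - 2 ≤ -2q^N + (q+1)(2q^N - 2)`), for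
`K` finite of characteristic `p`, `q = pⁿ`, `𝔽_q ⊆ K` (every `c` with `c^q = c` in a field over `K`
comes from `K`). [cite: Stichtenoth2009, Thm. 7.4.7 (proof) and Lemma 7.4.6] -/
theorem genus_level_le [Finite K] (hqp : q = p ^ n)
    (hFq : ∀ (L' : Type) [Field L'] [Algebra K L'] (c : L'), c ^ q = c → ∃ γ : K, algebraMap K L' γ = c)
    (N : ℕ) : (genus K (level K q N).carrier : ℤ) ≤ (q : ℤ) ^ (N + 1) - q := by
  set L := level K q N with hL
  haveI : IsIntegrallyClosedIn K L.carrier := isIntegrallyClosedIn_of_isRational L.isRational_Pinf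
  have hq2 := hq.out
  have hqK : (q : K) = 0 := Level.cast_q_eq_zero (K := K) hqp
  have hNL : L.N = N := level_N K q N
  obtain ⟨hGen, hBad⟩ := profile_level hqp hFq N
  obtain ⟨hω, hinf⟩ := L.differentialDivisor_Pinf_le hqK
  set W := differentialDivisor (dOf K (L.x 0)) with hW
  have hdeg : W.degree = 2 * (genus K L.carrier : ℤ) - 2 := degree_differentialDivisor hω
  -- the set `B ⊇ 𝔽_q ∩ K` and the bound function
  set B : Finset K := ((X ^ q - X : K[X]).roots).toFinset with hB
  have hBcard : B.card ≤ q := by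
    refine (Multiset.toFinset_card_le _).trans ?_
    have := Polynomial.card_roots' (X ^ q - X : K[X])
    rwa [FiniteField.X_pow_card_sub_X_natDegree_eq K (by omega)] at this
  have hmemB : ∀ β : K, β ^ q = β → β ∈ B := fun β hβ => by
    rw [hB, Multiset.mem_toFinset, mem_roots (FiniteField.X_pow_card_sub_X_ne_zero K (by omega)),
      IsRoot.def, eval_sub, eval_pow, eval_X, hβ, sub_self]
  set f : PlaceOver K L.carrier → K → ℤ := fun Q β =>
    if 0 < Q.ord (L.x 0 - algebraMap K L.carrier β)
    then (2 * Q.ord (L.x 0 - algebraMap K L.carrier β) - 2) * (Q.degree : ℤ) else 0 with hf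
  have hf0 : ∀ Q β, 0 ≤ f Q β := fun Q β => by
    simp only [hf]; split_ifs with h
    · have : (0 : ℤ) ≤ Q.degree := by positivity
      nlinarith
    · exact le_rfl
  have hx0O : ∀ Q : PlaceOver K L.carrier, L.x 0 ∈ Q.toValuationSubring → Q ≠ L.Pinf := by
    rintro Q hQ rfl
    have h := L.Pinf.ord_nonneg_of_mem hQ
    rw [L.ord_Pinf 0 (Nat.zero_le _)] at h
    have : (0 : ℤ) < (q : ℤ) ^ (L.N - 0) := by positivity
    omega
  -- place by place
  have hlocal : ∀ Q ∈ W.support, W Q * (Q.degree : ℤ) ≤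
      (if Q = L.Pinf then -2 else 0) + ∑ β ∈ B, f Q β := by
    intro Q _
    have hsum0 : 0 ≤ ∑ β ∈ B, f Q β := Finset.sum_nonneg fun β _ => hf0 Q β
    rcases L.trichotomy hFq Q with hpole | ⟨hO, hv⟩ | ⟨β, hβ, hord⟩
    · have hQ : Q = L.Pinf := L.eq_Pinf_of_ord_neg hpole
      subst hQ
      rw [if_pos rfl, L.isRational_Pinf, Nat.cast_one, mul_one]
      linarith
    · rw [if_neg (hx0O Q hO), zero_add]
      have hle := L.differentialDivisor_le_of_generic (hGen Q hO hv)
      have : W Q * (Q.degree : ℤ) ≤ 0 := mul_nonpos_of_nonpos_of_nonneg hle (by positivity)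
      linarith
    · obtain ⟨t, α, hbad⟩ := hBad Q β hβ hord
      have hO : L.x 0 ∈ Q.toValuationSubring := by
        have hmem : L.x 0 - algebraMap K L.carrier β ∈ Q.toValuationSubring :=
          (Q.mem_toValuationSubring_iff_ord_nonneg (Q.ne_zero_of_ord_ne_zero hord.ne')).2 hord.le
        have := add_mem hmem (Q.algebraMap_mem β)
        rwa [sub_add_cancel] at this
      rw [if_neg (hx0O Q hO), zero_add]
      have hle := L.differentialDivisor_le_of_bad hqK hbad
      calc W Q * (Q.degree : ℤ) ≤ (2 * Q.ord (L.x 0 - algebraMap K L.carrier β) - 2) * (Q.degree : ℤ) :=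
            mul_le_mul_of_nonneg_right hle (by positivity)
        _ = f Q β := by simp only [hf, if_pos hord]
        _ ≤ ∑ β' ∈ B, f Q β' := Finset.single_le_sum (fun β' _ => hf0 Q β') (hmemB β hβ)
  -- the fibre sums
  have hfibre : ∀ β ∈ B, ∑ Q ∈ W.support, f Q β ≤ 2 * (q : ℤ) ^ N - 2 := by
    intro β _
    have hz0 : L.x 0 - algebraMap K L.carrier β ≠ 0 := by
      have := L.aeval_x_ne_zero (Nat.zero_le _) (X_sub_C_ne_zero β)
      rwa [map_sub, aeval_X, aeval_C] at this
    have htr : Transcendental K (L.x 0 - algebraMap K L.carrier β) := by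
      intro halg
      have := halg.add (isAlgebraic_algebraMap (R := K) (A := L.carrier) β)
      rw [sub_add_cancel] at this
      exact L.transcendental_x (Nat.zero_le _) this
    set Z := (finite_setOf_ord_pos htr).toFinset with hZ
    have hZmem : ∀ Q, Q ∈ Z ↔ 0 < Q.ord (L.x 0 - algebraMap K L.carrier β) := fun Q => by
      rw [hZ, Set.Finite.mem_toFinset]; rfl
    have hZsum := L.sum_ord_sub_mul_degree β Z hZmem
    rw [hNL] at hZsum
    have h1 : ∑ Q ∈ W.support, f Q β ≤ ∑ Q ∈ W.support ∪ Z, f Q β :=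
      Finset.sum_le_sum_of_subset_of_nonneg Finset.subset_union_left fun Q _ _ => hf0 Q β
    have h2 : ∑ Q ∈ W.support ∪ Z, f Q β = ∑ Q ∈ Z, f Q β := by
      symm
      refine Finset.sum_subset Finset.subset_union_right fun Q _ hQ => ?_
      simp only [hf, if_neg ((hZmem Q).not.1 hQ)]
    have h3 : ∑ Q ∈ Z, f Q β = 2 * ∑ Q ∈ Z, Q.ord (L.x 0 - algebraMap K L.carrier β) * (Q.degree : ℤ) -
        2 * ∑ Q ∈ Z, (Q.degree : ℤ) := by
      rw [Finset.mul_sum, Finset.mul_sum, ← Finset.sum_sub_distrib]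
      exact Finset.sum_congr rfl fun Q hQ => by simp only [hf, if_pos ((hZmem Q).1 hQ)]; ring
    have hZne : Z.Nonempty := by
      by_contra hemp
      rw [Finset.not_nonempty_iff_eq_empty] at hemp
      rw [hemp, Finset.sum_empty] at hZsum
      exact absurd hZsum.symm (pow_ne_zero _ (by exact_mod_cast (by omega : q ≠ 0)))
    have h4 : (1 : ℤ) ≤ ∑ Q ∈ Z, (Q.degree : ℤ) := by
      obtain ⟨Q, hQ⟩ := hZne
      have := Finset.single_le_sum (fun Q' _ => (by positivity : (0 : ℤ) ≤ (Q'.degree : ℤ))) hQ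
      have hd : (1 : ℤ) ≤ Q.degree := by exact_mod_cast PlaceOver.degree_pos_holds Q
      linarith
    rw [h2, h3, hZsum] at h1
    linarith
  -- sum up
  have hPinf : L.Pinf ∈ W.support := by
    rw [Finsupp.mem_support_iff]; intro h0; rw [h0] at hinf; norm_num at hinf
  have htotal : W.degree ≤ -2 + (q : ℤ) * (2 * (q : ℤ) ^ N - 2) := by
    rw [Divisor.degree_apply, Finsupp.sum]
    calc ∑ Q ∈ W.support, W Q * (Q.degree : ℤ)
        ≤ ∑ Q ∈ W.support, ((if Q = L.Pinf then -2 else 0) + ∑ β ∈ B, f Q β) := Finset.sum_le_sum hlocal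
      _ = -2 + ∑ β ∈ B, ∑ Q ∈ W.support, f Q β := by
          rw [Finset.sum_add_distrib, Finset.sum_ite_eq' W.support L.Pinf, if_pos hPinf, Finset.sum_comm]
      _ ≤ -2 + ∑ β ∈ B, (2 * (q : ℤ) ^ N - 2) := by
          have := Finset.sum_le_sum hfibre; linarith
      _ = -2 + (B.card : ℤ) * (2 * (q : ℤ) ^ N - 2) := by rw [Finset.sum_const, nsmul_eq_mul]
      _ ≤ -2 + (q : ℤ) * (2 * (q : ℤ) ^ N - 2) := by
          have hBc : (B.card : ℤ) ≤ q := by exact_mod_cast hBcard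
          have : (0 : ℤ) ≤ 2 * (q : ℤ) ^ N - 2 := by
            have : (1 : ℤ) ≤ (q : ℤ) ^ N := one_le_pow₀ (by exact_mod_cast (by omega : 1 ≤ q))
            linarith
          nlinarith
  rw [hdeg] at htotal
  rw [pow_succ]
  nlinarith

end GSTower

end Literature.NumberTheory.DiophantineGeometry
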